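import Summits.CriticalPhenomena.CardyFormulaZ2.Theorems.CardySusyWardDiscretisationFamilyExistsTransportA
import Literature.Topology.PlaneTopology.Crosscut
import HarnessLib

/-!
# Transport of faces, the discrete boundary and regularity — helper for `DiscretisationFamilyExists` (stmt-CriticalPhenomena-9644)

Continuation of `…ExistsTransportA`.  A lattice isometry `(g, G)` comes with a bijection `gf` of
faces such that `x` is a corner of `f` iff `g x` is a corner of `gf f`; along it inner faces,
face-boundary edges and the discrete boundary `zdBoundary` of the bare data `⟨Ω, δ, ∅, ∅⟩`
correspond to those of `⟨G '' Ω, δ, ∅, ∅⟩`.  Also: the regularity package of `Ω` (open, frontier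
accessible from the exterior, exterior connected and unbounded, frontier nonempty) passes to
`G '' Ω`, and simple arcs are mapped to simple arcs.
-/

noncomputable section

open Set Metric
open Literature.Probability.LatticeModels Literature.Probability.Percolation
  Literature.Probability.LatticeModels.DiscreteDobrushin Literature.Topology.PlaneTopology

namespace Summit.CriticalPhenomena.CardyFormulaZ2.Theorems.DiscretisationFamilyExists

section Transport

variable {Ω : Set ℂ} {δ : ℝ} {g gf : Site 2 ≃ Site 2} {G : ℂ ≃ₗᵢ[ℝ] ℂ}

/-! ### Faces -/

/-- Corners of `gf f` are the `g`-images of the corners of `f` (inverse form). [folklore] -/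
theorem isCorner_symm_iff (hc : ∀ x f : Site 2, IsCorner (g x) (gf f) ↔ IsCorner x f)
    {x f : Site 2} : IsCorner x (gf f) ↔ IsCorner (g.symm x) f := by
  rw [← hc (g.symm x) f, Equiv.apply_symm_apply]

/-- **Inner faces along a lattice isometry.** [folklore] -/
theorem isInnerFace_map_iff (hδ : 0 < δ) (hG : ∀ x : Site 2, meshPoint δ (g x) = G (meshPoint δ x))
    (hc : ∀ x f : Site 2, IsCorner (g x) (gf f) ↔ IsCorner x f) {f : Site 2} :
    (⟨G '' Ω, δ, ∅, ∅⟩ : DiscreteDobrushin).IsInnerFace (gf f) ↔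
      (⟨Ω, δ, ∅, ∅⟩ : DiscreteDobrushin).IsInnerFace f := by
  constructor
  · intro h v w hv hw hvw
    have := h (g v) (g w) ((hc v f).2 hv) ((hc w f).2 hw) (zdAdj_map_of_adj hδ hG hvw)
    exact (ddg_adj_map_iff hδ hG).1 this
  · intro h v w hv hw hvw
    have hv' := (isCorner_symm_iff hc).1 hv
    have hw' := (isCorner_symm_iff hc).1 hw
    have hvw' : (zdGraph 2).Adj (g.symm v) (g.symm w) := by
      rw [← zdAdj_map_iff hδ hG (g := g)]; simpa using hvw
    have := (ddg_adj_map_iff hδ hG (g := g)).2 (h _ _ hv' hw' hvw')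
    simpa using this

/-- **Face-boundary edges along a lattice isometry.** [folklore] -/
theorem isFaceBoundaryEdge_map_iff (hδ : 0 < δ) (hG : ∀ x : Site 2, meshPoint δ (g x) = G (meshPoint δ x))
    (hc : ∀ x f : Site 2, IsCorner (g x) (gf f) ↔ IsCorner x f) {x y : Site 2} :
    (⟨G '' Ω, δ, ∅, ∅⟩ : DiscreteDobrushin).IsFaceBoundaryEdge (g x) (g y) ↔
      (⟨Ω, δ, ∅, ∅⟩ : DiscreteDobrushin).IsFaceBoundaryEdge x y := by
  unfold DiscreteDobrushin.IsFaceBoundaryEdge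
  have hddg : (discreteDomainGraph (G '' Ω) δ).Adj (g x) (g y) ↔ (discreteDomainGraph Ω δ).Adj x y :=
    ddg_adj_map_iff hδ hG
  have hex : ∀ P : Site 2 → Prop, (∀ f, P (gf f) ↔ (⟨Ω, δ, ∅, ∅⟩ : DiscreteDobrushin).IsInnerFace f) →
      ((∃ f, P f ∧ IsCorner (g x) f ∧ IsCorner (g y) f) ↔
        ∃ f, (⟨Ω, δ, ∅, ∅⟩ : DiscreteDobrushin).IsInnerFace f ∧ IsCorner x f ∧ IsCorner y f) := by
    intro P hP
    constructor
    · rintro ⟨f, hf, hx, hy⟩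
      refine ⟨gf.symm f, (hP _).1 (by simpa using hf), ?_, ?_⟩
      · rw [← hc, Equiv.apply_symm_apply]; exact hx
      · rw [← hc, Equiv.apply_symm_apply]; exact hy
    · rintro ⟨f, hf, hx, hy⟩
      exact ⟨gf f, (hP f).2 hf, (hc x f).2 hx, (hc y f).2 hy⟩
  have hexn : (∃ f, ¬ (⟨G '' Ω, δ, ∅, ∅⟩ : DiscreteDobrushin).IsInnerFace f ∧ IsCorner (g x) f ∧ IsCorner (g y) f) ↔
      ∃ f, ¬ (⟨Ω, δ, ∅, ∅⟩ : DiscreteDobrushin).IsInnerFace f ∧ IsCorner x f ∧ IsCorner y f := by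
    constructor
    · rintro ⟨f, hf, hx, hy⟩
      refine ⟨gf.symm f, fun h => hf ?_, ?_, ?_⟩
      · have := (isInnerFace_map_iff hδ hG hc (f := gf.symm f)).2 h; simpa using this
      · rw [← hc, Equiv.apply_symm_apply]; exact hx
      · rw [← hc, Equiv.apply_symm_apply]; exact hy
    · rintro ⟨f, hf, hx, hy⟩
      exact ⟨gf f, fun h => hf ((isInnerFace_map_iff hδ hG hc).1 h), (hc x f).2 hx, (hc y f).2 hy⟩
  rw [hddg, hex _ (fun f => isInnerFace_map_iff hδ hG hc), hexn]

/-- **The discrete boundary along a lattice isometry.** [folklore] -/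
theorem mem_zdBoundary_map_iff (hδ : 0 < δ) (hG : ∀ x : Site 2, meshPoint δ (g x) = G (meshPoint δ x))
    (hc : ∀ x f : Site 2, IsCorner (g x) (gf f) ↔ IsCorner x f) {x : Site 2} :
    g x ∈ (⟨G '' Ω, δ, ∅, ∅⟩ : DiscreteDobrushin).zdBoundary ↔
      x ∈ (⟨Ω, δ, ∅, ∅⟩ : DiscreteDobrushin).zdBoundary := by
  rw [DiscreteDobrushin.mem_zdBoundary_iff, DiscreteDobrushin.mem_zdBoundary_iff]
  refine or_congr (mem_meshBoundary_map_iff hδ hG) ⟨?_, ?_⟩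
  · rintro ⟨y, hy⟩
    refine ⟨g.symm y, (isFaceBoundaryEdge_map_iff hδ hG hc).1 ?_⟩
    simpa using hy
  · rintro ⟨y, hy⟩
    exact ⟨g y, (isFaceBoundaryEdge_map_iff hδ hG hc).2 hy⟩

/-! ### Regularity of the image domain -/

/-- The exterior of the closure of the image. [folklore] -/
theorem compl_closure_image (G : ℂ ≃ₗᵢ[ℝ] ℂ) (Ω : Set ℂ) :
    (closure (G '' Ω))ᶜ = G '' (closure Ω)ᶜ := by
  rw [← image_closure', Set.image_compl_eq G.bijective]

/-- **Regularity passes to the image**: frontier accessible from the exterior. [folklore] -/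
theorem frontier_image_subset (G : ℂ ≃ₗᵢ[ℝ] ℂ) {Ω : Set ℂ}
    (hJE : frontier Ω ⊆ closure (closure Ω)ᶜ) :
    frontier (G '' Ω) ⊆ closure (closure (G '' Ω))ᶜ := by
  rw [← image_frontier', compl_closure_image, ← image_closure']
  exact image_mono hJE

/-- Regularity passes to the image: the exterior is connected. [folklore] -/
theorem isConnected_compl_closure_image (G : ℂ ≃ₗᵢ[ℝ] ℂ) {Ω : Set ℂ}
    (hext : IsConnected (closure Ω)ᶜ) : IsConnected (closure (G '' Ω))ᶜ := by
  rw [compl_closure_image]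
  exact hext.image _ G.continuous.continuousOn

/-- Regularity passes to the image: the exterior is unbounded. [folklore] -/
theorem not_isBounded_compl_closure_image (G : ℂ ≃ₗᵢ[ℝ] ℂ) {Ω : Set ℂ}
    (hunb : ¬ Bornology.IsBounded (closure Ω)ᶜ) : ¬ Bornology.IsBounded (closure (G '' Ω))ᶜ := by
  rw [compl_closure_image]
  intro h
  apply hunb
  have := G.symm.lipschitz.isBounded_image h
  rwa [symm_image_image] at this

/-- The frontier of the image is nonempty if the frontier is. [folklore] -/
theorem frontier_image_nonempty (G : ℂ ≃ₗᵢ[ℝ] ℂ) {Ω : Set ℂ} (hne : (frontier Ω).Nonempty) :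
    (frontier (G '' Ω)).Nonempty := by
  rw [← image_frontier']; exact hne.image _

/-! ### Simple arcs -/

/-- **Simple arcs are mapped to simple arcs.** [folklore] -/
theorem isSimpleArc_image (G : ℂ ≃ₗᵢ[ℝ] ℂ) {L : Set ℂ} {a b : ℂ} (h : IsSimpleArc L a b) :
    IsSimpleArc (G '' L) (G a) (G b) := by
  obtain ⟨γ, hγ, hinj, hL, ha, hb⟩ := h
  refine ⟨G ∘ γ, G.continuous.comp_continuousOn hγ, G.injective.comp_injOn hinj, ?_, by simp [ha], by simp [hb]⟩
  rw [image_comp, hL]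

end Transport

end Summit.CriticalPhenomena.CardyFormulaZ2.Theorems.DiscretisationFamilyExists

end
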